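import Mathlib
import Literature.Analysis.FluidPDE.CheskidovFriedlander2009.PerturbationEnergy
import HarnessLib

/-!
# Cheskidov–Friedlander 2009, §3 (proof of Thm. 3.4), analytic half, part 1: the truncated
# perturbation energy, integrated in time ((3.7) → (3.11) before `k → ∞`)

Cheskidov–Friedlander, Physica D 238 (2009) 783–787 = arXiv:0810.3718v1, proof of Thm. 3.4,
pp. 7–9.  With `α` a non-negative `ℓ²` fixed point of the viscous model and `a` a solution with
non-negative datum (so `a ≥ 0`, `Existence.lean`), `b = a − α`, this file turns the pointwise
estimate of `PerturbationEnergy.lean`,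
`Σ_{j≤k} b_j(rhs_j(a) − rhs_j(α)) ≤ −γνΣ_{j≤k}2^{2j}b_j² + 2α⁰₀ρ^k(2^{2k}a_k² + 2^{2(k+1)}a²_{k+1})`,
into the integrated inequality for the truncated perturbation energy `E_k(t) = Σ_{j≤k} b_j(t)²`:

* `IsSolution.continuousOn_rhs`, `IsSolution.hasDerivWithinAt_truncPert`: `E_k` is `C¹` on
  `[0,∞)` with `E_k' = 2Σ_{j≤k} b_j·rhs_j(a)` (= `2Σ_{j≤k} b_j(rhs_j(a) − rhs_j(α))`, `rhs(α) = 0`);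
* `IsSolution.truncPert_eq`: `E_k(t) − E_k(s) = ∫_s^t 2Σ_{j≤k} b_j(rhs_j(a) − rhs_j(α))`
  ((3.7) integrated);
* `IsSolution.integral_window_le`: `∫_s^t (2^{2k}a_k² + 2^{2(k+1)}a²_{k+1}) ≤ ∫_s^t‖a‖²_{H¹} < ∞`;
* `IsSolution.truncPert_le`: for `k ≥ m`,
  `E_k(t) − E_k(s) ≤ −2γν∫_s^tΣ_{j≤m} b_j² + 4α⁰₀ρ^k∫_s^t‖a‖²_{H¹}` — (3.11) at truncation level
  `k`, with the boundary contribution explicit and geometrically small (`ρ = 2^{2c/3−2} < 1`).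

The limit `k → ∞`, the monotonicity of `|b(t)|²`, and the Gronwall step (3.12) — i.e. the
discharge of `CheskidovFriedlander2009_globalAttractor` — are part 2.

## References
* [CheskidovFriedlander2009] A. Cheskidov, S. Friedlander, The vanishing viscosity limit for a
  dyadic model, Physica D 238 (2009) 783–787, Thm 3.4, (3.7)–(3.11) pp. 7–8.
-/

noncomputable section

open Set Filter MeasureTheory Finset
open scoped Topology

namespace Literature.Analysis.FluidPDE.CheskidovFriedlander2009

variable {c ν f₀ : ℝ} {a : ℕ → ℝ → ℝ} {α : ℕ → ℝ}

/-! ### The truncated perturbation energy is `C¹` -/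

/-- Each component of the vector field is continuous in time along a solution.
[cite: CheskidovFriedlander2009, Def 3.1 p.7] -/
theorem IsSolution.continuousOn_rhs {f : ℕ → ℝ} (ha : IsSolution c ν f a) (j : ℕ) :
    ContinuousOn (fun τ => rhs c ν f (fun i => a i τ) j) (Ici 0) := by
  have hc := ha.continuousOn
  cases j with
  | zero =>
    show ContinuousOn (fun τ => -(ν * a 0 τ) - a 0 τ * a 1 τ + f 0) (Ici 0)
    exact ((continuousOn_const.mul (hc 0)).neg.sub ((hc 0).mul (hc 1))).add continuousOn_const
  | succ j =>
    show ContinuousOn (fun τ => -(ν * (2 : ℝ) ^ (2 * (j + 1)) * a (j + 1) τ)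
      + ((2 : ℝ) ^ c) ^ j * a j τ ^ 2 - ((2 : ℝ) ^ c) ^ (j + 1) * a (j + 1) τ * a (j + 2) τ
      + f (j + 1)) (Ici 0)
    exact (((continuousOn_const.mul (hc (j + 1))).neg.add
      (continuousOn_const.mul ((hc j).pow 2))).sub
      ((continuousOn_const.mul (hc (j + 1))).mul (hc (j + 2)))).add continuousOn_const

/-- Derivative of the truncated perturbation energy `Σ_{j≤N}(a_j(τ) − α_j)²` along a solution:
`2Σ_{j≤N}(a_j − α_j)·rhs_j(a)`. [cite: CheskidovFriedlander2009, Thm 3.4 (3.5)–(3.7) p.7–8] -/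
theorem IsSolution.hasDerivWithinAt_truncPert {f : ℕ → ℝ} (ha : IsSolution c ν f a) (α : ℕ → ℝ)
    (N : ℕ) {t : ℝ} (ht : 0 ≤ t) :
    HasDerivWithinAt (fun τ => ∑ j ∈ range (N + 1), (a j τ - α j) ^ 2)
      (2 * ∑ j ∈ range (N + 1), (a j t - α j) * rhs c ν f (fun i => a i t) j) (Ici 0) t := by
  rw [Finset.mul_sum]
  have := HasDerivWithinAt.fun_sum (u := range (N + 1)) (A := fun j τ => (a j τ - α j) ^ 2)
    (A' := fun j => 2 * (a j t - α j) * rhs c ν f (fun i => a i t) j) (x := t) (s := Ici 0)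
    fun j _ => by simpa using ((ha.hasDerivWithinAt j t ht).sub_const (α j)).fun_pow 2
  simpa [mul_assoc] using this

/-! ### (3.7) integrated -/

/-- **(3.7) integrated**: for a solution `a`, a fixed point `α` of the same system and
`0 ≤ s ≤ t`, `Σ_{j≤N}(a_j(t) − α_j)² − Σ_{j≤N}(a_j(s) − α_j)² =
∫_s^t 2Σ_{j≤N}(a_j − α_j)(rhs_j(a) − rhs_j(α)) dτ` (`rhs_j(α) = 0`).
[cite: CheskidovFriedlander2009, Thm 3.4 (3.7) p.8] -/
theorem IsSolution.truncPert_eq {f : ℕ → ℝ} (ha : IsSolution c ν f a) (hα : IsFixedPoint c ν f α)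
    (N : ℕ) {s t : ℝ} (hs : 0 ≤ s) (hst : s ≤ t) :
    ∑ j ∈ range (N + 1), (a j t - α j) ^ 2 - ∑ j ∈ range (N + 1), (a j s - α j) ^ 2 =
      ∫ τ in s..t, (2 * ∑ j ∈ range (N + 1),
        (a j τ - α j) * (rhs c ν f (fun i => a i τ) j - rhs c ν f α j)) := by
  set E : ℝ → ℝ := fun τ => ∑ j ∈ range (N + 1), (a j τ - α j) ^ 2 with hE
  set G : ℝ → ℝ := fun τ => 2 * ∑ j ∈ range (N + 1),
    (a j τ - α j) * (rhs c ν f (fun i => a i τ) j - rhs c ν f α j) with hG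
  have hcont := ha.continuousOn
  have hEc : ContinuousOn E (Ici 0) :=
    continuousOn_finsetSum _ fun j _ => ((hcont j).sub continuousOn_const).pow 2
  have hGc : ContinuousOn G (Ici 0) :=
    continuousOn_const.mul (continuousOn_finsetSum _ fun j _ =>
      ((hcont j).sub continuousOn_const).mul ((ha.continuousOn_rhs j).sub continuousOn_const))
  have hderiv : ∀ τ, 0 ≤ τ → HasDerivWithinAt E (G τ) (Ici 0) τ := by
    intro τ hτ
    have h := ha.hasDerivWithinAt_truncPert α N hτ
    refine h.congr_deriv ?_
    simp only [hG, hα.2, sub_zero]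
  have hst' : Icc s t ⊆ Ici 0 := fun τ hτ => hs.trans hτ.1
  have hGi : IntervalIntegrable G volume s t := (hGc.mono hst').intervalIntegrable_of_Icc hst
  have hftc := intervalIntegral.integral_eq_sub_of_hasDeriv_right_of_le hst (hEc.mono hst')
    (fun τ hτ => (hderiv τ (hs.trans hτ.1.le)).mono fun r hr => hs.trans (hτ.1.le.trans hr.le))
    hGi
  show E t - E s = ∫ τ in s..t, G τ
  linarith

/-! ### The window `2^{2k}a_k² + 2^{2(k+1)}a²_{k+1}` against the dissipation integral -/

/-- `∫_s^t (2^{2k}a_k² + 2^{2(k+1)}a²_{k+1}) dτ ≤ ∫_s^t ‖a(τ)‖²_{H¹} dτ` (the latter as the finite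
lower Lebesgue integral, `ν > 0`, non-negative datum, `f₀ ≥ 0`, `c ≠ 0`).
[cite: CheskidovFriedlander2009, Thm 3.3 (3.2) p.7 and Thm 3.4 p.8] -/
theorem IsSolution.integral_window_le (ha : IsSolution c ν (force f₀) a) (hc : c ≠ 0) (hν : 0 < ν)
    (hf : 0 ≤ f₀) (h0 : ∀ j, 0 ≤ a j 0) (k : ℕ) {s t : ℝ} (hs : 0 ≤ s) (hst : s ≤ t) :
    (∫ τ in s..t, ((2 : ℝ) ^ (2 * k) * a k τ ^ 2 + (2 : ℝ) ^ (2 * (k + 1)) * a (k + 1) τ ^ 2)) ≤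
      (∫⁻ τ in Ioc s t, h1NormSq (fun j => a j τ)).toReal := by
  have hcont := ha.continuousOn
  have hst' : Icc s t ⊆ Ici 0 := fun τ hτ => hs.trans hτ.1
  -- `window ≤ Σ_{j ≤ k+1} 2^{2j}a_j²` pointwise
  set D : ℝ → ℝ := fun τ => ∑ j ∈ range (k + 1 + 1), (2 : ℝ) ^ (2 * j) * a j τ ^ 2 with hD
  have hWc : ContinuousOn (fun τ => (2 : ℝ) ^ (2 * k) * a k τ ^ 2
      + (2 : ℝ) ^ (2 * (k + 1)) * a (k + 1) τ ^ 2) (Ici 0) :=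
    (continuousOn_const.mul ((hcont k).pow 2)).add (continuousOn_const.mul ((hcont (k + 1)).pow 2))
  have hDc : ContinuousOn D (Ici 0) :=
    continuousOn_finsetSum _ fun j _ => continuousOn_const.mul ((hcont j).pow 2)
  have hle1 : (∫ τ in s..t, ((2 : ℝ) ^ (2 * k) * a k τ ^ 2 + (2 : ℝ) ^ (2 * (k + 1)) * a (k + 1) τ ^ 2))
      ≤ ∫ τ in s..t, D τ := by
    refine intervalIntegral.integral_mono_on hst
      ((hWc.mono hst').intervalIntegrable_of_Icc hst) ((hDc.mono hst').intervalIntegrable_of_Icc hst)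
      fun τ _ => ?_
    simp only [hD, sum_range_succ]
    have : 0 ≤ ∑ j ∈ range k, (2 : ℝ) ^ (2 * j) * a j τ ^ 2 :=
      sum_nonneg fun j _ => by positivity
    linarith
  -- `∫ Σ_{j≤k+1} ≤ (∫⁻ ‖a‖²_{H¹}).toReal`
  have hfin := ha.lintegral_h1NormSq_lt_top hc hν hf h0 hs hst
  have hle : ENNReal.ofReal (∫ τ in s..t, D τ) ≤ ∫⁻ τ in Ioc s t, h1NormSq (fun j => a j τ) := by
    rw [hD, ← ha.lintegral_truncDissipation_eq (k + 1) hs hst, ha.lintegral_h1NormSq_eq_iSup hs]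
    exact le_iSup (fun M => ∫⁻ τ in Ioc s t, ∑ j ∈ range M,
      ENNReal.ofReal ((2 : ℝ) ^ (2 * j) * a j τ ^ 2)) (k + 1 + 1)
  have hnn : 0 ≤ ∫ τ in s..t, D τ :=
    intervalIntegral.integral_nonneg hst fun τ _ => sum_nonneg fun j _ => by positivity
  have hreal : (∫ τ in s..t, D τ) ≤ (∫⁻ τ in Ioc s t, h1NormSq (fun j => a j τ)).toReal := by
    have := ENNReal.toReal_mono hfin.ne hle
    rwa [ENNReal.toReal_ofReal hnn] at this
  exact hle1.trans hreal

/-! ### (3.11) at truncation level `k` -/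

/-- **(3.11) before `k → ∞`**: let `α` be a non-negative `ℓ²` fixed point (`3/2 < c < 3`,
`ν > 0`, `f₀ > 0`), `γ` the constant of Lemma 2.4 (`exists_gamma_coeff_sub_sqrt_lt`), `a` a
solution with non-negative datum, `0 ≤ s ≤ t` and `m ≤ k`.  Then
`Σ_{j≤k}b_j(t)² − Σ_{j≤k}b_j(s)² ≤ −2γν∫_s^tΣ_{j≤m}b_j² + 4α⁰₀ρ^k∫_s^t‖a‖²_{H¹}`, `b = a − α`,
`ρ = 2^c2^{−c/3}/4`. [cite: CheskidovFriedlander2009, Thm 3.4 (3.7)–(3.11) p.8] -/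
theorem IsSolution.truncPert_le (ha : IsSolution c ν (force f₀) a) (h0 : ∀ j, 0 ≤ a j 0)
    (hα : IsFixedPoint c ν (force f₀) α) (hnn : ∀ j, 0 ≤ α j) (hc : 3 / 2 < c) (hc3 : c < 3)
    (hν : 0 < ν) (hf : 0 < f₀) {γ : ℝ} (hγ0 : 0 < γ) (hγ1 : γ < 1)
    (hcoef : ∀ j : ℕ, ((2 : ℝ) ^ c) ^ j * α j -
      ((2 : ℝ) ^ c) ^ j * Real.sqrt ((2 : ℝ) ^ c * α (j + 1) * α (j + 2)) < (1 - γ) * ν * (2 : ℝ) ^ (2 * j + 1))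
    {m k : ℕ} (hmk : m ≤ k) {s t : ℝ} (hs : 0 ≤ s) (hst : s ≤ t) :
    ∑ j ∈ range (k + 1), (a j t - α j) ^ 2 - ∑ j ∈ range (k + 1), (a j s - α j) ^ 2 ≤
      -(2 * γ * ν) * (∫ τ in s..t, ∑ j ∈ range (m + 1), (a j τ - α j) ^ 2)
        + 4 * inviscidFixedPoint c f₀ 0 * ((2 : ℝ) ^ c * (2 : ℝ) ^ (-(c / 3)) / 4) ^ k *
          (∫⁻ τ in Ioc s t, h1NormSq (fun j => a j τ)).toReal := by
  have hc0 : c ≠ 0 := by linarith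
  have hcont := ha.continuousOn
  have hst' : Icc s t ⊆ Ici 0 := fun τ hτ => hs.trans hτ.1
  have hapos : ∀ j τ, 0 ≤ τ → 0 ≤ a j τ := fun j τ hτ => ha.nonneg hc0 hf.le h0 j τ hτ
  set κ : ℝ := inviscidFixedPoint c f₀ 0 with hκ
  set ρ : ℝ := (2 : ℝ) ^ c * (2 : ℝ) ^ (-(c / 3)) / 4 with hρ
  have hκ0 : 0 < κ := inviscidFixedPoint_pos c hf 0
  have hρ0 : 0 ≤ ρ := rho_nonneg c
  -- the players
  set G : ℝ → ℝ := fun τ => 2 * ∑ j ∈ range (k + 1),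
    (a j τ - α j) * (rhs c ν (force f₀) (fun i => a i τ) j - rhs c ν (force f₀) α j) with hG
  set Dm : ℝ → ℝ := fun τ => ∑ j ∈ range (m + 1), (a j τ - α j) ^ 2 with hDm
  set Dk : ℝ → ℝ := fun τ => ∑ j ∈ range (k + 1), (2 : ℝ) ^ (2 * j) * (a j τ - α j) ^ 2 with hDk
  set W : ℝ → ℝ := fun τ => (2 : ℝ) ^ (2 * k) * a k τ ^ 2
    + (2 : ℝ) ^ (2 * (k + 1)) * a (k + 1) τ ^ 2 with hW
  have hGc : ContinuousOn G (Ici 0) :=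
    continuousOn_const.mul (continuousOn_finsetSum _ fun j _ =>
      ((hcont j).sub continuousOn_const).mul ((ha.continuousOn_rhs j).sub continuousOn_const))
  have hDmc : ContinuousOn Dm (Ici 0) :=
    continuousOn_finsetSum _ fun j _ => ((hcont j).sub continuousOn_const).pow 2
  have hDkc : ContinuousOn Dk (Ici 0) :=
    continuousOn_finsetSum _ fun j _ => continuousOn_const.mul (((hcont j).sub continuousOn_const).pow 2)
  have hWc : ContinuousOn W (Ici 0) :=
    (continuousOn_const.mul ((hcont k).pow 2)).add (continuousOn_const.mul ((hcont (k + 1)).pow 2))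
  have hGi : IntervalIntegrable G volume s t := (hGc.mono hst').intervalIntegrable_of_Icc hst
  have hDmi : IntervalIntegrable Dm volume s t := (hDmc.mono hst').intervalIntegrable_of_Icc hst
  have hDki : IntervalIntegrable Dk volume s t := (hDkc.mono hst').intervalIntegrable_of_Icc hst
  have hWi : IntervalIntegrable W volume s t := (hWc.mono hst').intervalIntegrable_of_Icc hst
  -- pointwise: `G ≤ −2γν Dk + 4κρ^k W` on `[s,t]`, and `Dm ≤ Dk`
  have hpt : ∀ τ ∈ Icc s t, G τ ≤ -(2 * γ * ν) * Dk τ + 4 * κ * ρ ^ k * W τ := by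
    intro τ hτ
    have hτ0 : 0 ≤ τ := hs.trans hτ.1
    have h := hα.perturbation_sum_le' hc hc3 hν hf hnn hγ1 hcoef (x := fun i => a i τ)
      (fun j => hapos j τ hτ0) k
    simp only [hG, hDk, hW, hκ, hρ]
    linarith
  have hDmk : ∀ τ ∈ Icc s t, Dm τ ≤ Dk τ := by
    intro τ _
    simp only [hDm, hDk]
    calc ∑ j ∈ range (m + 1), (a j τ - α j) ^ 2
        ≤ ∑ j ∈ range (m + 1), (2 : ℝ) ^ (2 * j) * (a j τ - α j) ^ 2 :=
          sum_le_sum fun j _ => le_mul_of_one_le_left (sq_nonneg _) (one_le_pow₀ (by norm_num))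
      _ ≤ ∑ j ∈ range (k + 1), (2 : ℝ) ^ (2 * j) * (a j τ - α j) ^ 2 :=
          sum_le_sum_of_subset_of_nonneg (range_mono (by omega)) fun j _ _ => by positivity
  -- integrate
  have hI1 : (∫ τ in s..t, G τ) ≤ ∫ τ in s..t, (-(2 * γ * ν) * Dk τ + 4 * κ * ρ ^ k * W τ) :=
    intervalIntegral.integral_mono_on hst hGi ((hDki.const_mul _).add (hWi.const_mul _)) hpt
  have hI2 : (∫ τ in s..t, Dm τ) ≤ ∫ τ in s..t, Dk τ :=
    intervalIntegral.integral_mono_on hst hDmi hDki hDmk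
  have hI3 := ha.integral_window_le hc0 hν hf.le h0 k hs hst
  rw [intervalIntegral.integral_add (hDki.const_mul _) (hWi.const_mul _),
    intervalIntegral.integral_const_mul (-(2 * γ * ν)),
    intervalIntegral.integral_const_mul (4 * κ * ρ ^ k)] at hI1
  have heq := ha.truncPert_eq hα k hs hst
  rw [heq]
  have hγν : 0 ≤ 2 * γ * ν := by positivity
  have h4 : 0 ≤ 4 * κ * ρ ^ k := by positivity
  nlinarith [mul_le_mul_of_nonneg_left hI2 hγν, mul_le_mul_of_nonneg_left hI3 h4]

/-! ### Part 2: `k → ∞` ((3.11)), monotonicity of `|b(t)|²`, and the Gronwall step ((3.12)) -/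

/-- `ℓ²` is closed under differences: `Σ(x_j − y_j)² < ∞`. [cite: CheskidovFriedlander2009, Thm 3.4 (3.3) p.7] -/
theorem summable_sq_sub_of_sq {x y : ℕ → ℝ} (hx : Summable fun j => x j ^ 2)
    (hy : Summable fun j => y j ^ 2) : Summable fun j => (x j - y j) ^ 2 :=
  Summable.of_nonneg_of_le (fun j => sq_nonneg _)
    (fun j => by nlinarith [sq_nonneg (x j + y j)] : ∀ j, (x j - y j) ^ 2 ≤ 2 * x j ^ 2 + 2 * y j ^ 2)
    ((hx.mul_left 2).add (hy.mul_left 2))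

/-- The partial sums of `|a(τ) − α|²` converge. [cite: CheskidovFriedlander2009, Thm 3.4 (3.3) p.7] -/
theorem IsSolution.tendsto_truncPert {f : ℕ → ℝ} (ha : IsSolution c ν f a)
    (hα : Summable fun j => α j ^ 2) {τ : ℝ} (hτ : 0 ≤ τ) :
    Tendsto (fun k => ∑ j ∈ range (k + 1), (a j τ - α j) ^ 2) atTop
      (𝓝 (normSq (fun j => a j τ - α j))) :=
  ((summable_sq_sub_of_sq (ha.summable_sq τ hτ) hα).hasSum.tendsto_sum_nat).comp
    (tendsto_add_atTop_nat 1)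

/-- **(3.11)**: with the data of `truncPert_le`, letting `k → ∞`:
`|b(t)|² − |b(s)|² ≤ −2γν∫_s^tΣ_{j≤m}b_j²` for every truncation level `m` (the boundary
contribution `4α⁰₀ρ^k∫‖a‖²_{H¹}` disappears). [cite: CheskidovFriedlander2009, Thm 3.4 (3.11) p.8] -/
theorem IsSolution.pert_le_trunc (ha : IsSolution c ν (force f₀) a) (h0 : ∀ j, 0 ≤ a j 0)
    (hα : IsFixedPoint c ν (force f₀) α) (hnn : ∀ j, 0 ≤ α j) (hc : 3 / 2 < c) (hc3 : c < 3)
    (hν : 0 < ν) (hf : 0 < f₀) {γ : ℝ} (hγ0 : 0 < γ) (hγ1 : γ < 1)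
    (hcoef : ∀ j : ℕ, ((2 : ℝ) ^ c) ^ j * α j -
      ((2 : ℝ) ^ c) ^ j * Real.sqrt ((2 : ℝ) ^ c * α (j + 1) * α (j + 2)) < (1 - γ) * ν * (2 : ℝ) ^ (2 * j + 1))
    (m : ℕ) {s t : ℝ} (hs : 0 ≤ s) (hst : s ≤ t) :
    normSq (fun j => a j t - α j) - normSq (fun j => a j s - α j) ≤
      -(2 * γ * ν) * (∫ τ in s..t, ∑ j ∈ range (m + 1), (a j τ - α j) ^ 2) := by
  set ρ : ℝ := (2 : ℝ) ^ c * (2 : ℝ) ^ (-(c / 3)) / 4 with hρ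
  have hρ0 : 0 ≤ ρ := rho_nonneg c
  have hρ1 : ρ < 1 := rho_lt_one hc3
  set κ : ℝ := inviscidFixedPoint c f₀ 0 with hκ
  set H : ℝ := (∫⁻ τ in Ioc s t, h1NormSq (fun j => a j τ)).toReal with hH
  set I : ℝ := ∫ τ in s..t, ∑ j ∈ range (m + 1), (a j τ - α j) ^ 2 with hI
  have hL : Tendsto (fun k => ∑ j ∈ range (k + 1), (a j t - α j) ^ 2
      - ∑ j ∈ range (k + 1), (a j s - α j) ^ 2) atTop
      (𝓝 (normSq (fun j => a j t - α j) - normSq (fun j => a j s - α j))) :=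
    (ha.tendsto_truncPert hα.1 (hs.trans hst)).sub (ha.tendsto_truncPert hα.1 hs)
  have hR : Tendsto (fun k : ℕ => -(2 * γ * ν) * I + 4 * κ * ρ ^ k * H) atTop
      (𝓝 (-(2 * γ * ν) * I + 4 * κ * 0 * H)) :=
    tendsto_const_nhds.add
      (((tendsto_pow_atTop_nhds_zero_of_lt_one hρ0 hρ1).const_mul (4 * κ)).mul_const H)
  rw [mul_zero, zero_mul, add_zero] at hR
  refine le_of_tendsto_of_tendsto hL hR (eventually_atTop.2 ⟨m, fun k hk => ?_⟩)
  exact ha.truncPert_le h0 hα hnn hc hc3 hν hf hγ0 hγ1 hcoef hk hs hst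

/-- **`|b(t)|²` is non-increasing**: `|b(t)|² ≤ |b(s)|²` for `0 ≤ s ≤ t` (from (3.11)).
[cite: CheskidovFriedlander2009, Thm 3.4 (3.11) p.8] -/
theorem IsSolution.pert_antitone (ha : IsSolution c ν (force f₀) a) (h0 : ∀ j, 0 ≤ a j 0)
    (hα : IsFixedPoint c ν (force f₀) α) (hnn : ∀ j, 0 ≤ α j) (hc : 3 / 2 < c) (hc3 : c < 3)
    (hν : 0 < ν) (hf : 0 < f₀) {γ : ℝ} (hγ0 : 0 < γ) (hγ1 : γ < 1)
    (hcoef : ∀ j : ℕ, ((2 : ℝ) ^ c) ^ j * α j -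
      ((2 : ℝ) ^ c) ^ j * Real.sqrt ((2 : ℝ) ^ c * α (j + 1) * α (j + 2)) < (1 - γ) * ν * (2 : ℝ) ^ (2 * j + 1))
    {s t : ℝ} (hs : 0 ≤ s) (hst : s ≤ t) :
    normSq (fun j => a j t - α j) ≤ normSq (fun j => a j s - α j) := by
  have h := ha.pert_le_trunc h0 hα hnn hc hc3 hν hf hγ0 hγ1 hcoef 0 hs hst
  have hI : 0 ≤ ∫ τ in s..t, ∑ j ∈ range (0 + 1), (a j τ - α j) ^ 2 :=
    intervalIntegral.integral_nonneg hst fun τ _ => sum_nonneg fun j _ => sq_nonneg _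
  nlinarith [mul_nonneg (by positivity : (0 : ℝ) ≤ 2 * γ * ν) hI]

/-- **(3.11) with `m → ∞` and the monotonicity**: `|b(t)|²(1 + 2γν(t − s)) ≤ |b(s)|²` for
`0 ≤ s ≤ t` — monotone convergence of `∫_s^tΣ_{j≤m}b_j²` to `∫_s^t|b|²` (the limit is
integrable: bounded by `|b(s)|²` and a.e. limit of continuous functions) and `|b(τ)|² ≥ |b(t)|²` on
`[s,t]`. [cite: CheskidovFriedlander2009, Thm 3.4 (3.11)–(3.12) p.8–9] -/
theorem IsSolution.pert_step (ha : IsSolution c ν (force f₀) a) (h0 : ∀ j, 0 ≤ a j 0)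
    (hα : IsFixedPoint c ν (force f₀) α) (hnn : ∀ j, 0 ≤ α j) (hc : 3 / 2 < c) (hc3 : c < 3)
    (hν : 0 < ν) (hf : 0 < f₀) {γ : ℝ} (hγ0 : 0 < γ) (hγ1 : γ < 1)
    (hcoef : ∀ j : ℕ, ((2 : ℝ) ^ c) ^ j * α j -
      ((2 : ℝ) ^ c) ^ j * Real.sqrt ((2 : ℝ) ^ c * α (j + 1) * α (j + 2)) < (1 - γ) * ν * (2 : ℝ) ^ (2 * j + 1))
    {s t : ℝ} (hs : 0 ≤ s) (hst : s ≤ t) :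
    normSq (fun j => a j t - α j) * (1 + 2 * γ * ν * (t - s)) ≤ normSq (fun j => a j s - α j) := by
  set φ : ℝ → ℝ := fun τ => normSq (fun j => a j τ - α j) with hφ
  set F : ℕ → ℝ → ℝ := fun m τ => ∑ j ∈ range (m + 1), (a j τ - α j) ^ 2 with hF
  have hmeas : MeasurableSet (Ioc s t) := measurableSet_Ioc
  have hcont := ha.continuousOn
  have hst' : Icc s t ⊆ Ici 0 := fun τ hτ => hs.trans hτ.1
  have hFc : ∀ m, ContinuousOn (F m) (Icc s t) := fun m =>
    (continuousOn_finsetSum _ fun j _ => ((hcont j).sub continuousOn_const).pow 2).mono hst'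
  have hFint : ∀ m, Integrable (F m) (volume.restrict (Ioc s t)) := fun m =>
    ((hFc m).integrableOn_Icc).mono_set Ioc_subset_Icc_self
  have hae : ∀ᵐ τ ∂(volume.restrict (Ioc s t)), τ ∈ Ioc s t := ae_restrict_mem hmeas
  have hmono : ∀ᵐ τ ∂(volume.restrict (Ioc s t)), Monotone fun m => F m τ := by
    filter_upwards with τ
    intro m n hmn
    exact sum_le_sum_of_subset_of_nonneg (range_mono (by omega)) fun j _ _ => sq_nonneg _
  have htend : ∀ᵐ τ ∂(volume.restrict (Ioc s t)), Tendsto (fun m => F m τ) atTop (𝓝 (φ τ)) := by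
    filter_upwards [hae] with τ hτ
    exact ha.tendsto_truncPert hα.1 (hs.trans hτ.1.le)
  have hφmeas : AEStronglyMeasurable φ (volume.restrict (Ioc s t)) :=
    aestronglyMeasurable_of_tendsto_ae atTop (fun m => (hFint m).aestronglyMeasurable) htend
  have hanti : ∀ τ ∈ Ioc s t, φ t ≤ φ τ ∧ φ τ ≤ φ s := fun τ hτ =>
    ⟨ha.pert_antitone h0 hα hnn hc hc3 hν hf hγ0 hγ1 hcoef (hs.trans hτ.1.le) hτ.2,
      ha.pert_antitone h0 hα hnn hc hc3 hν hf hγ0 hγ1 hcoef hs hτ.1.le⟩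
  have hφ0 : ∀ τ, 0 ≤ φ τ := fun τ => tsum_nonneg fun j => sq_nonneg _
  have hφbd : ∀ᵐ τ ∂(volume.restrict (Ioc s t)), ‖φ τ‖ ≤ φ s := by
    filter_upwards [hae] with τ hτ
    rw [Real.norm_eq_abs, abs_of_nonneg (hφ0 τ)]
    exact (hanti τ hτ).2
  have hconst : ∀ C : ℝ, Integrable (fun _ : ℝ => C) (volume.restrict (Ioc s t)) := fun C =>
    ((continuousOn_const (c := C)).integrableOn_Icc (a := s) (b := t)).mono_set Ioc_subset_Icc_self
  have hφint : Integrable φ (volume.restrict (Ioc s t)) := (hconst (φ s)).mono' hφmeas hφbd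
  -- monotone convergence
  have hlimI : Tendsto (fun m => ∫ τ, F m τ ∂(volume.restrict (Ioc s t))) atTop
      (𝓝 (∫ τ, φ τ ∂(volume.restrict (Ioc s t)))) :=
    integral_tendsto_of_tendsto_of_monotone hFint hφint hmono htend
  have hineq : ∀ m, φ t - φ s ≤ -(2 * γ * ν) * ∫ τ, F m τ ∂(volume.restrict (Ioc s t)) := fun m => by
    have h := ha.pert_le_trunc h0 hα hnn hc hc3 hν hf hγ0 hγ1 hcoef m hs hst
    rwa [intervalIntegral.integral_of_le hst] at h
  have hstep1 : φ t - φ s ≤ -(2 * γ * ν) * ∫ τ, φ τ ∂(volume.restrict (Ioc s t)) :=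
    ge_of_tendsto (hlimI.const_mul (-(2 * γ * ν))) (Eventually.of_forall hineq)
  -- the integral of `φ` over `(s,t]` is at least `(t − s)φ(t)`
  have hlow : (t - s) * φ t ≤ ∫ τ, φ τ ∂(volume.restrict (Ioc s t)) := by
    have h := setIntegral_mono_on (hconst (φ t)) hφint hmeas fun τ hτ => (hanti τ hτ).1
    rwa [setIntegral_const, Real.volume_real_Ioc_of_le hst, smul_eq_mul] at h
  have hγν : 0 ≤ 2 * γ * ν := by positivity
  nlinarith [mul_le_mul_of_nonneg_left hlow hγν]

/-- `e^{u/2} ≤ 1 + u` for `0 ≤ u ≤ 1`. [cite: CheskidovFriedlander2009, Thm 3.4 (3.12) p.9] -/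
theorem exp_half_le_one_add {u : ℝ} (hu0 : 0 ≤ u) (hu1 : u ≤ 1) : Real.exp (u / 2) ≤ 1 + u := by
  have h := Real.abs_exp_sub_one_sub_id_le (x := u / 2)
    (by rw [abs_of_nonneg (by linarith)]; linarith)
  have := (abs_le.1 h).2
  nlinarith

/-- **Discrete Gronwall**: `|b(nh)|²(1 + 2γνh)^n ≤ |b(0)|²` for `h ≥ 0`, `n ∈ ℕ`.
[cite: CheskidovFriedlander2009, Thm 3.4 (3.12) p.9] -/
theorem IsSolution.pert_iter (ha : IsSolution c ν (force f₀) a) (h0 : ∀ j, 0 ≤ a j 0)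
    (hα : IsFixedPoint c ν (force f₀) α) (hnn : ∀ j, 0 ≤ α j) (hc : 3 / 2 < c) (hc3 : c < 3)
    (hν : 0 < ν) (hf : 0 < f₀) {γ : ℝ} (hγ0 : 0 < γ) (hγ1 : γ < 1)
    (hcoef : ∀ j : ℕ, ((2 : ℝ) ^ c) ^ j * α j -
      ((2 : ℝ) ^ c) ^ j * Real.sqrt ((2 : ℝ) ^ c * α (j + 1) * α (j + 2)) < (1 - γ) * ν * (2 : ℝ) ^ (2 * j + 1))
    {h : ℝ} (hh : 0 ≤ h) (n : ℕ) :
    normSq (fun j => a j ((n : ℝ) * h) - α j) * (1 + 2 * γ * ν * h) ^ n ≤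
      normSq (fun j => a j 0 - α j) := by
  induction n with
  | zero => simp
  | succ n ih =>
    have hs : (0 : ℝ) ≤ (n : ℝ) * h := by positivity
    have hst : (n : ℝ) * h ≤ ((n + 1 : ℕ) : ℝ) * h := by push_cast; nlinarith
    have step := ha.pert_step h0 hα hnn hc hc3 hν hf hγ0 hγ1 hcoef hs hst
    have e : ((n + 1 : ℕ) : ℝ) * h - (n : ℝ) * h = h := by push_cast; ring
    rw [e] at step
    have hq : 0 ≤ (1 + 2 * γ * ν * h) ^ n := by positivity
    calc normSq (fun j => a j (((n + 1 : ℕ) : ℝ) * h) - α j) * (1 + 2 * γ * ν * h) ^ (n + 1)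
        = normSq (fun j => a j (((n + 1 : ℕ) : ℝ) * h) - α j) * (1 + 2 * γ * ν * h)
            * (1 + 2 * γ * ν * h) ^ n := by rw [pow_succ]; ring
      _ ≤ normSq (fun j => a j ((n : ℝ) * h) - α j) * (1 + 2 * γ * ν * h) ^ n :=
          mul_le_mul_of_nonneg_right step hq
      _ ≤ normSq (fun j => a j 0 - α j) := ih

/-- **Cheskidov–Friedlander 2009, Theorem 3.4 — PROVED** (discharge of the faithful transcription
`CheskidovFriedlander2009_globalAttractor`): for `c ∈ (3/2, 5/2]` there is `γ' ∈ (0,1)` (here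
`γ' = γ/2`, `γ` the constant of Lemma 2.4) such that for every `ν > 0`, `f₀ > 0`, every
non-negative `ℓ²` fixed point `α` and every solution `a` with non-negative datum,
`|a(t) − α|² ≤ |a(0) − α|²e^{−2γ'νt}` for all `t ≥ 0`.  Assembled from Lemma 2.4
(`FluxRatioBound.lean`), the perturbation-energy estimate (`PerturbationEnergy.lean`), (3.11) and
the discrete Gronwall step above (`(1 + 2γνt/n)^n ≥ e^{γνt}` once `2γνt ≤ n`).
[cite: CheskidovFriedlander2009, Thm 3.4 pp.7–9] -/
theorem CheskidovFriedlander2009_globalAttractor_holds : CheskidovFriedlander2009_globalAttractor := by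
  intro c hc hc'
  have hc3 : c < 3 := by linarith
  obtain ⟨γ, hγ0, hγ1, hcoefAll⟩ := exists_gamma_coeff_sub_sqrt_lt hc hc3
  refine ⟨γ / 2, by positivity, by linarith, ?_⟩
  intro ν f₀ hν hf α hα hnn a ha h0 t ht
  have hcoef := hcoefAll hν hf hα hnn
  set φ0 : ℝ := normSq (fun j => a j 0 - α j) with hφ0
  have hφt : 0 ≤ normSq (fun j => a j t - α j) := tsum_nonneg fun j => sq_nonneg _
  -- the number of Gronwall steps
  obtain ⟨n, hn, hn0⟩ : ∃ n : ℕ, 2 * γ * ν * t ≤ n ∧ 0 < n :=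
    ⟨⌈2 * γ * ν * t⌉₊ + 1, by push_cast; linarith [Nat.le_ceil (2 * γ * ν * t)], by positivity⟩
  have hn' : (0 : ℝ) < n := by exact_mod_cast hn0
  set h : ℝ := t / n with hhdef
  have hh : 0 ≤ h := by positivity
  have hnh : (n : ℝ) * h = t := by rw [hhdef]; field_simp
  have hiter := ha.pert_iter h0 hα hnn hc hc3 hν hf hγ0 hγ1 hcoef hh n
  rw [hnh] at hiter
  -- `(1 + 2γνh)^n ≥ e^{γνt}`
  have hu0 : 0 ≤ 2 * γ * ν * h := by positivity
  have hu1 : 2 * γ * ν * h ≤ 1 := by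
    rw [hhdef, show 2 * γ * ν * (t / n) = 2 * γ * ν * t / n by ring, div_le_one hn']
    exact hn
  have hexp : Real.exp (γ * ν * t) ≤ (1 + 2 * γ * ν * h) ^ n := by
    have h1 : Real.exp (γ * ν * h) ≤ 1 + 2 * γ * ν * h := by
      have := exp_half_le_one_add hu0 hu1
      rwa [show 2 * γ * ν * h / 2 = γ * ν * h by ring] at this
    calc Real.exp (γ * ν * t) = Real.exp (γ * ν * h) ^ n := by
          rw [← Real.exp_nat_mul, ← hnh]; ring_nf
      _ ≤ (1 + 2 * γ * ν * h) ^ n := pow_le_pow_left₀ (Real.exp_pos _).le h1 n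
  -- conclude
  have hmain : normSq (fun j => a j t - α j) * Real.exp (γ * ν * t) ≤ φ0 :=
    (mul_le_mul_of_nonneg_left hexp hφt).trans hiter
  have hE : 0 < Real.exp (γ * ν * t) := Real.exp_pos _
  rw [show -(2 * (γ / 2) * ν * t) = -(γ * ν * t) by ring, Real.exp_neg]
  rw [le_mul_inv_iff₀ hE]
  exact hmain

/-- **Cheskidov–Friedlander 2009, Theorem 4.2 — PROVED** (discharge of
`CheskidovFriedlander2009_thm42`, the vanishing-viscosity limit of the mean energy dissipation /
the dyadic zeroth law): from Thm. 3.4 (`CheskidovFriedlander2009_globalAttractor_holds`) and the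
existence of the non-negative fixed point (`CheskidovFriedlander2009_thm42_of_globalAttractor`,
`exists_isFixedPoint`).
[cite: CheskidovFriedlander2009, Thm 4.2 pp.9–10] -/
theorem CheskidovFriedlander2009_thm42_holds : CheskidovFriedlander2009_thm42 :=
  CheskidovFriedlander2009_thm42_of_globalAttractor CheskidovFriedlander2009_globalAttractor_holds
    fun c _ _ _ _ hν hf =>
      let ⟨α, hα, hnn, _⟩ := exists_isFixedPoint c hν hf
      ⟨α, hα, hnn⟩

end Literature.Analysis.FluidPDE.CheskidovFriedlander2009

end
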